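import Literature.NumberTheory.EllipticCurves.Kato2004.IwasawaH1ReductionKernel
import Literature.NumberTheory.EllipticCurves.WeilPairingTateDual
import Mathlib.CategoryTheory.CofilteredSystem
import Mathlib.CategoryTheory.Functor.OfSequence
import HarnessLib

/-!
# Kato 2004 (Astérisque 295) §13.8 on the pin `IwasawaH1Data`: norm-compatible `p`-th roots, and
# `ker red ⊆ p·𝐇¹` REDUCED to the integrality of norm-compatible families (Lemma 8.5 (2))

Topic `NumberTheory/EllipticCurves`, sub-directory `Kato2004` (namespace = path).  Cell `bsd-smallim`
(rung K6 of `BirchSwinnertonDyer`, class X9, crux `MuTransferX9` = item 19276), seat `bsd-smallim-k6-g4`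
(gen 2).  THEOREMS ONLY (no definition, no named fact, no `sorry`).  Second step towards the named
fact `Kato2004.mem_pSmul_of_red_eq_zero` (`IwasawaH1Reduction.lean` §4; first conjunct of the crux's
cite-only stub `stub_factsX9`), after the levelwise kernel `reduceH1_eq_zero_iff`
(`IwasawaH1ReductionKernel.lean`: `ker (red : H¹(U, T_pW) → H¹(U, W[p])) = p·H¹(U, T_pW)`).

## What

* §1 `exists_cocycle_prime_nsmul_eq` — division by `p` of a continuous crossed map `c : U → T_pW`
  whose values reduce to `0` modulo `p` (the cochain engine of the kernel file, as a lemma).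
* §2 **`finite_setOf_prime_smul_eq_zero`** — `H¹(U, T_pW)[p]` is FINITE: every `p`-torsion class is
  `δ(P)` for a `U`-fixed `P ∈ W[p]` (`p • c = ∂m`, `P = m mod p`), and `δ(P)` depends only on `P`
  (the connecting map of `0 → T_pW →p T_pW → W[p] → 0`, on cochains); `W[p]` is finite
  (`finite_geomTorsion_of_neZero`).  Hence **`finite_setOf_prime_smul_eq`**: the set of `p`-th roots
  `{z | p • z = y}` of any class `y` is finite (a torsor under `H¹(U, T_pW)[p]`, or empty).
* §3 **`exists_normCompatible_roots`** — on the pin `I : IwasawaH1Data W p κ γ`: if `I.red x = 0` then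
  there is a family `z = (z_n)`, `z_n ∈ H¹(ℚ_n, T_pW)`, with `p • z_n = proj n x` for all `n` AND
  `Cor(z_{n+1}) = z_n` (König's lemma `nonempty_sections_of_finite_inverse_system` on the finite
  non-empty root sets, which the trace maps `layerCores` preserve because `Cor(proj (n+1) x) = proj n x`).
* §4 **`mem_pSmul_of_red_eq_zero_of_integral`** — the named fact `mem_pSmul_of_red_eq_zero` FOLLOWS from
  the integrality of norm-compatible families along the layers of the cyclotomic `κ`
  (`∀ z, (∀ n, Cor (z (n+1)) = z n) → ∀ n, z n ∈ integralH1`: Kato's Lemma 8.5 (2) "the image of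
  `lim←_n H¹(K(ζ_{p^n}), T) → H¹(K, T)` is contained in the image of `H¹(O_K[1/p], T)`", read on the
  pin's layers): then `z ∈ lim←_n H¹(ℤ_n[1/p], T_pW) = 𝐇¹` (`proj_surjective`), and `x = p • z`
  levelwise gives `x = C(p) • z ∈ (p) • 𝐇¹` (`proj_C_smul`, `ext_of_proj`).  So after this file the
  named fact is REDUCED to Lemma 8.5 (2) (local Iwasawa theory at `v ∤ p`: universal norms in
  `H¹(ℚ_{n,w}, T_pE)` are unramified), which is not proved here.

## The printed statements (K. Kato, Astérisque 295 (2004))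

* **§13.8 [p. 229]** "`𝐇¹(T)/x𝐇¹(T) ⊂ H¹(ℤ[1/p], T ⊗_{O_λ} Λ/xΛ)`" (`x = p`).
* **Lemma 8.5 (2) [p. 183]** "The image of `lim←_n H¹(K(ζ_{p^n}), T) → H¹(K, T)` is contained in the
  image of `H¹(O_K[1/p], T) → H¹(K, T)`."

References: K. Kato, Astérisque 295 (2004) §8.2, Lemma 8.5, §12.2, §13.8 [Kato2004Asterisque];
K. Rubin, *Euler Systems* (2000) App. B Prop. B.2.3, B.3.3 [Rubin2000]; J.-P. Serre, *Galois Cohomology*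
(1997) I §2.2 [SerreGaloisCohomology1997]; D. Kőnig's lemma for inverse systems of finite sets
(Mathlib `nonempty_sections_of_finite_inverse_system`).
-/

noncomputable section

open scoped NumberField
open Field CategoryTheory
open Literature.NumberTheory.GaloisRepresentations
open Literature.NumberTheory.EllipticCurves Literature.NumberTheory.EllipticCurves.Kato2004
open Literature.NumberTheory.EllipticCurves.Kato2004.EulerSystemValues
open WeierstrassCurve (geomPoints geomTorsion)

universe u

namespace Literature.NumberTheory.EllipticCurves.Kato2004

variable (W : WeierstrassCurve ℚ) [W.IsElliptic] (p : ℕ) [Fact p.Prime]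
  [ContinuousSMul ℤ_[p] (W.tateModule p)]

/-! ## §1 Dividing a `p`-divisible continuous crossed map by `p` -/

/-- **Division by `p` on crossed maps.**  A continuous map `c : U → T_pW` satisfying the crossed
homomorphism identity whose values reduce to `0` in `W[p]` (`(c g)_1 = 0`) is `p • d` for a
continuous crossed homomorphism `d` (`(d g)_n = (c g)_{n+1}`; the identity for `d` holds because
`T_pW` has no `p`-torsion).  [cite: Kato2004Asterisque, §13.8 (p. 228)] -/
theorem exists_cocycle_prime_nsmul_eq (U : Subgroup (absoluteGaloisGroup ℚ))
    (c : U → W.tateModule p) (hc : Continuous c)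
    (hmul : ∀ g h : U, c (g * h) = c g + (subgroupRep (tateRep W p).toTopRep U).ρ g (c h))
    (h1 : ∀ g, TateModule.proj p 1 (c g) = 0) :
    ∃ d : contOneCocycles (subgroupRep (tateRep W p).toTopRep U), ∀ g, p • d.1 g = c g := by
  let d₀ : U → W.tateModule p := fun g =>
    TateModule.mk (fun n => TateModule.proj p (n + 1) (c g))
      (fun n => by rw [TateModule.pow_smul_proj_succ, h1])
      (fun n => TateModule.smul_proj_succ (n + 1) (c g))
  have hd₀ : ∀ g, p • d₀ g = c g := fun g => by
    refine TateModule.ext fun n => ?_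
    rw [map_nsmul, TateModule.proj_mk, TateModule.smul_proj_succ]
  have hd₀cont : Continuous d₀ := by
    refine continuous_induced_rng.mpr (continuous_pi fun n => ?_)
    exact (TateModule.continuous_proj (n + 1)).comp hc
  have hdmul : ∀ g h : U, d₀ (g * h) = d₀ g + (subgroupRep (tateRep W p).toTopRep U).ρ g (d₀ h) :=
    fun g h => by
    refine TateModule.eq_of_prime_nsmul_eq ?_
    rw [hd₀, nsmul_add, hd₀, ← map_nsmul, hd₀, hmul]
  exact ⟨⟨⟨d₀, hd₀cont⟩, hdmul⟩, hd₀⟩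

/-! ## §2 `H¹(U, T_pW)[p]` is finite; the `p`-th roots of a class form a finite set -/

/-- The coboundary crossed map `g ↦ g m − m` of `m ∈ T_pW` is continuous and satisfies the crossed
homomorphism identity. [cite: SerreGaloisCohomology1997, I §2.2] -/
theorem continuous_coboundary_and_mul (U : Subgroup (absoluteGaloisGroup ℚ)) (m : W.tateModule p) :
    Continuous (fun g : U => (subgroupRep (tateRep W p).toTopRep U).ρ g m - m) ∧
      ∀ g h : U, (subgroupRep (tateRep W p).toTopRep U).ρ (g * h) m - m =
        ((subgroupRep (tateRep W p).toTopRep U).ρ g m - m) +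
          (subgroupRep (tateRep W p).toTopRep U).ρ g ((subgroupRep (tateRep W p).toTopRep U).ρ h m - m) := by
  refine ⟨(((tateRep W p).continuous_apply_left m).comp continuous_subtype_val).sub continuous_const,
    fun g h => ?_⟩
  have hgh : (subgroupRep (tateRep W p).toTopRep U).ρ (g * h) m =
      (subgroupRep (tateRep W p).toTopRep U).ρ g ((subgroupRep (tateRep W p).toTopRep U).ρ h m) := by
    rw [map_mul]; rfl
  rw [hgh, map_sub]
  abel

/-- **`H¹(U, T_pW)[p]` is finite.**  A class `t` with `p • t = 0` is represented by `p⁻¹ ∂m` for some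
`m ∈ T_pW` whose reduction `P = m mod p ∈ W[p]` is `U`-fixed, and the class only depends on `P`
(if `m ≡ m' (mod p)` the two cocycles differ by a coboundary) — i.e. `H¹(U, T_pW)[p] = δ(W[p]^U)` for
the connecting map of `0 → T_pW →p T_pW → W[p] → 0`; and `W[p]` is finite.
[cite: Kato2004Asterisque, §13.8 (p. 228)] [cite: SerreGaloisCohomology1997, I §2.2] -/
theorem finite_setOf_prime_smul_eq_zero (U : Subgroup (absoluteGaloisGroup ℚ)) :
    Set.Finite {t : H1 (tateRep W p) U | (p : ℤ_[p]) • t = 0} := by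
  classical
  haveI : NeZero p := ⟨(Fact.out : p.Prime).ne_zero⟩
  haveI : Finite (geomTorsion W (p : ℤ)) := finite_geomTorsion_of_neZero W p
  -- a lift `m_P ∈ T_pW` of every `P ∈ W[p]`
  have hlift : ∀ P : geomTorsion W (p : ℤ), ∃ m : W.tateModule p,
      TateModule.proj p 1 m = (P : geomPoints W) := fun P => by
    have hP : (P : geomPoints W) ∈ geomTorsion W (p ^ 1 : ℕ) := by rw [pow_one]; exact P.2
    exact W.proj_surjective_of_isAlgClosed_holds p 1 hP
  choose lift hlift using hlift
  -- the cocycle `p⁻¹ ∂(m_P)` for `U`-fixed `P`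
  have hδ : ∀ P : geomTorsion W (p : ℤ),
      (∀ g : U, (g : absoluteGaloisGroup ℚ) • (P : geomPoints W) = P) →
      ∃ d : contOneCocycles (subgroupRep (tateRep W p).toTopRep U),
        ∀ g, p • d.1 g = (subgroupRep (tateRep W p).toTopRep U).ρ g (lift P) - lift P := fun P hP => by
    obtain ⟨hcont, hmul⟩ := continuous_coboundary_and_mul W p U (lift P)
    refine exists_cocycle_prime_nsmul_eq W p U _ hcont hmul fun g => ?_
    rw [map_sub]
    change TateModule.proj p 1 ((g : absoluteGaloisGroup ℚ) • lift P) - _ = 0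
    rw [TateModule.proj_smul_of_distribMulAction, hlift, hP g, sub_self]
  -- the map `δ : W[p] → H¹(U, T_pW)` (zero off the fixed points)
  let δ : geomTorsion W (p : ℤ) → H1 (tateRep W p) U := fun P =>
    if hP : ∀ g : U, (g : absoluteGaloisGroup ℚ) • (P : geomPoints W) = P then
      oneCocycleClass _ (Classical.choose (hδ P hP)) else 0
  refine (Set.finite_range δ).subset fun t ht => ?_
  -- a `p`-torsion class is `δ` of the reduction of its coboundary witness
  obtain ⟨c, rfl⟩ := oneCocycleClass_surjective _ t
  have ht' : oneCocycleClass _ ((p : ℤ_[p]) • c) = 0 := by rw [oneCocycleClass_smul]; exact ht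
  rw [oneCocycleClass_eq_zero_iff] at ht'
  obtain ⟨m, hm⟩ := ht'
  have hm' : ∀ g : U, p • c.1 g = (subgroupRep (tateRep W p).toTopRep U).ρ g m - m := fun g => by
    rw [← hm g, Submodule.coe_smul, ContinuousMap.smul_apply, Nat.cast_smul_eq_nsmul]
  let P : geomTorsion W (p : ℤ) := tateModP W p m
  have hPfix : ∀ g : U, (g : absoluteGaloisGroup ℚ) • (P : geomPoints W) = P := fun g => by
    have h := congrArg (TateModule.proj p 1) (hm' g)
    rw [map_nsmul, map_sub] at h
    change p • TateModule.proj p 1 (c.1 g) =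
      TateModule.proj p 1 ((g : absoluteGaloisGroup ℚ) • m) - TateModule.proj p 1 m at h
    rw [TateModule.proj_smul_of_distribMulAction] at h
    have h0 : p • TateModule.proj p 1 (c.1 g) = 0 := by
      have := TateModule.pow_smul_proj 1 (c.1 g); rwa [pow_one] at this
    rw [h0, eq_comm, sub_eq_zero] at h
    exact h
  refine ⟨P, ?_⟩
  simp only [δ, dif_pos hPfix]
  -- the chosen cocycle for `P` and `c` differ by the coboundary of `b`, `m − m_P = p • b`
  have hd := Classical.choose_spec (hδ P hPfix)
  set d := Classical.choose (hδ P hPfix) with hd_def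
  have hmP : TateModule.proj p 1 (m - lift P) = 0 := by
    rw [map_sub, hlift, sub_eq_zero]; rfl
  obtain ⟨b, hb, -⟩ := TateModule.exists_prime_nsmul_eq_of_proj_one_eq_zero _ hmP
  rw [← sub_eq_zero, ← oneCocycleClass_sub, oneCocycleClass_eq_zero_iff]
  refine ⟨-b, fun g => ?_⟩
  rw [Submodule.coe_sub, ContinuousMap.sub_apply]
  refine TateModule.eq_of_prime_nsmul_eq ?_
  rw [nsmul_sub, hd g, hm' g, nsmul_sub, ← map_nsmul, neg_nsmul, hb, map_neg, map_sub]
  abel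

/-- **The `p`-th roots of a class form a finite set**: `{z ∈ H¹(U, T_pW) | p • z = y}` is empty or a
torsor under the finite group `H¹(U, T_pW)[p]`. [cite: Kato2004Asterisque, §13.8 (p. 228)] -/
theorem finite_setOf_prime_smul_eq (U : Subgroup (absoluteGaloisGroup ℚ)) (y : H1 (tateRep W p) U) :
    Set.Finite {z : H1 (tateRep W p) U | (p : ℤ_[p]) • z = y} := by
  by_cases h : ∃ z₀ : H1 (tateRep W p) U, (p : ℤ_[p]) • z₀ = y
  · obtain ⟨z₀, hz₀⟩ := h
    refine ((finite_setOf_prime_smul_eq_zero W p U).image fun t => t + z₀).subset fun z hz => ?_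
    refine ⟨z - z₀, ?_, sub_add_cancel z z₀⟩
    change (p : ℤ_[p]) • (z - z₀) = 0
    rw [smul_sub, hz₀]
    exact sub_eq_zero.mpr hz
  · refine Set.Finite.subset Set.finite_empty fun z hz => h ⟨z, hz⟩

/-! ## §3 Norm-compatible `p`-th roots on the pin (König's lemma) -/

variable {W p} {κ : ZpExtension ℚ p} {γ : absoluteGaloisGroup ℚ}

/-- **Norm-compatible `p`-th roots.**  On the pin `I : IwasawaH1Data W p κ γ`: if every levelwise
reduction of `x ∈ 𝐇¹` vanishes (`I.red x = 0`), there is a family `z_n ∈ H¹(ℚ_n, T_pW)` with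
`p • z_n = proj n x` and `Cor(z_{n+1}) = z_n` for all `n` (the root sets are finite and non-empty by
§2 and `reduceH1_eq_zero_iff`, the trace maps `layerCores` map roots to roots since
`Cor(proj (n+1) x) = proj n x`; König's lemma for inverse systems of finite non-empty sets).
[cite: Kato2004Asterisque, §13.8 (p. 228) with §12.2 (p. 220)] -/
theorem exists_normCompatible_roots (I : IwasawaH1Data W p κ γ) (x : I.H) (hx : I.red x = 0) :
    ∃ z : ∀ n : ℕ, H1 (tateRep W p) (κ.layerSubgroup n),
      (∀ n, (p : ℤ_[p]) • z n = I.proj n x) ∧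
        ∀ n, layerCores (tateRep W p) κ n (z (n + 1)) = z n := by
  -- the root sets and the trace maps between them
  let X : ℕ → Type := fun n => {z : H1 (tateRep W p) (κ.layerSubgroup n) // (p : ℤ_[p]) • z = I.proj n x}
  let f₀ : ∀ n, X (n + 1) → X n := fun n z =>
    ⟨layerCores (tateRep W p) κ n z.1, by rw [← map_smul, z.2, I.cores_proj]⟩
  let f : ∀ n, X (n + 1) ⟶ X n := fun n => TypeCat.ofHom (f₀ n)
  let F : ℕᵒᵖ ⥤ Type := Functor.ofOpSequence (X := X) f
  haveI : ∀ j : ℕᵒᵖ, Finite (F.obj j) := fun j => by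
    change Finite (X j.unop)
    exact (finite_setOf_prime_smul_eq W p (κ.layerSubgroup j.unop) (I.proj j.unop x)).to_subtype
  haveI : ∀ j : ℕᵒᵖ, Nonempty (F.obj j) := fun j => by
    change Nonempty (X j.unop)
    have h0 : reduceH1 W p (κ.layerSubgroup j.unop) (I.proj j.unop x) = 0 := by
      have := congrFun hx j.unop
      rwa [IwasawaH1Data.red_apply] at this
    obtain ⟨z, hz⟩ := (reduceH1_eq_zero_iff W p _ _).mp h0
    exact ⟨⟨z, hz⟩⟩
  obtain ⟨s, hs⟩ := nonempty_sections_of_finite_inverse_system F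
  refine ⟨fun n => (s (Opposite.op n) : X n).1, fun n => (s (Opposite.op n) : X n).2, fun n => ?_⟩
  have h := hs (homOfLE (Nat.le_add_right n 1)).op
  rw [Functor.ofOpSequence_map_homOfLE_succ] at h
  have h' := congrArg Subtype.val h
  simp only [f] at h'
  exact h'

/-! ## §4 `ker red ⊆ p·𝐇¹` reduced to the integrality of norm-compatible families -/

/-- **Kato §13.8 on the pin, REDUCED to Lemma 8.5 (2).**  If norm-compatible families of classes of
`T_pW` along the layers of the cyclotomic `ℤ_p`-extension are integral (unramified away from `p`:
`z_n ∈ H¹(ℤ_n[1/p], T_pW)`, Kato's Lemma 8.5 (2) in the pin's currency — the hypothesis `hint`), then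
the named fact `Kato2004.mem_pSmul_of_red_eq_zero` holds: `I.red x = 0 → x ∈ (p) • 𝐇¹`.  Proof:
norm-compatible `p`-th roots `z` (§3) are then an element of `lim←_n H¹(ℤ_n[1/p], T_pW)`, i.e. of `𝐇¹`
(`proj_surjective`), and `x = C(p) • z` levelwise (`proj_C_smul`, `ext_of_proj`).
[cite: Kato2004Asterisque, §13.8 (pp. 228–229) with Lemma 8.5 (2) (p. 183)] -/
theorem mem_pSmul_of_red_eq_zero_of_integral
    (hint : ∀ (W : WeierstrassCurve ℚ) [W.IsElliptic] (p : ℕ) [Fact p.Prime]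
      [ContinuousSMul ℤ_[p] (W.tateModule p)] (κ : ZpExtension ℚ p), κ.IsCyclotomic →
      ∀ z : ∀ n : ℕ, H1 (tateRep W p) (κ.layerSubgroup n),
        (∀ n, layerCores (tateRep W p) κ n (z (n + 1)) = z n) →
          ∀ n, z n ∈ integralH1 (tateRep W p) p (κ.layerSubgroup n)) :
    mem_pSmul_of_red_eq_zero := by
  intro W _ p _ _ κ γ hκ _hγ I x hx
  obtain ⟨z, hz, hcor⟩ := exists_normCompatible_roots I x hx
  have hnc : IsNormCompatible (tateRep W p) κ z := ⟨hint W p κ hκ z hcor, hcor⟩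
  obtain ⟨y, hy⟩ := I.proj_surjective z hnc
  have hxy : x = (PowerSeries.C (p : ℤ_[p]) : IwasawaAlgebra p) • y := by
    refine I.ext_of_proj fun n => ?_
    rw [I.proj_C_smul, hy n, hz n]
  rw [hxy, IwasawaAlgebra.augIdealP, Submodule.ideal_span_singleton_smul,
    Submodule.mem_smul_pointwise_iff_exists]
  exact ⟨y, Submodule.mem_top, rfl⟩

/-- **Kato §13.8 on the pin from the WEAK form of Lemma 8.5 (2)** — the hypothesis shape the cell
proves in-tree (STATUS l.373: "a norm-compatible family whose `p`-multiples are integral is integral",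
finite group theory + the Mackey formula, no Frobenius weights): if for every cyclotomic `κ` every family
`z_n ∈ H¹(ℚ_n, T_pW)` with `Cor(z_{n+1}) = z_n` and `p • z_n ∈ H¹(ℤ_n[1/p], T_pW)` for all `n` has every
`z_n` integral, then `Kato2004.mem_pSmul_of_red_eq_zero` holds.  Same proof as
`mem_pSmul_of_red_eq_zero_of_integral`: the norm-compatible `p`-th roots `z` of `x` (§3) have
`p • z_n = proj n x` integral (`IwasawaH1Data.proj_mem`).
[cite: Kato2004Asterisque, §13.8 (pp. 228–229) with Lemma 8.5 (2) (p. 183)] -/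
theorem mem_pSmul_of_red_eq_zero_of_integral_of_smul_mem
    (hint : ∀ (W : WeierstrassCurve ℚ) [W.IsElliptic] (p : ℕ) [Fact p.Prime]
      [ContinuousSMul ℤ_[p] (W.tateModule p)] (κ : ZpExtension ℚ p), κ.IsCyclotomic →
      ∀ z : ∀ n : ℕ, H1 (tateRep W p) (κ.layerSubgroup n),
        (∀ n, layerCores (tateRep W p) κ n (z (n + 1)) = z n) →
          (∀ n, (p : ℤ_[p]) • z n ∈ integralH1 (tateRep W p) p (κ.layerSubgroup n)) →
            ∀ n, z n ∈ integralH1 (tateRep W p) p (κ.layerSubgroup n)) :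
    mem_pSmul_of_red_eq_zero := by
  intro W _ p _ _ κ γ hκ _hγ I x hx
  obtain ⟨z, hz, hcor⟩ := exists_normCompatible_roots I x hx
  have hpz : ∀ n, (p : ℤ_[p]) • z n ∈ integralH1 (tateRep W p) p (κ.layerSubgroup n) := fun n => by
    rw [hz n]; exact I.proj_mem n x
  have hnc : IsNormCompatible (tateRep W p) κ z := ⟨hint W p κ hκ z hcor hpz, hcor⟩
  obtain ⟨y, hy⟩ := I.proj_surjective z hnc
  have hxy : x = (PowerSeries.C (p : ℤ_[p]) : IwasawaAlgebra p) • y := by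
    refine I.ext_of_proj fun n => ?_
    rw [I.proj_C_smul, hy n, hz n]
  rw [hxy, IwasawaAlgebra.augIdealP, Submodule.ideal_span_singleton_smul,
    Submodule.mem_smul_pointwise_iff_exists]
  exact ⟨y, Submodule.mem_top, rfl⟩

end Literature.NumberTheory.EllipticCurves.Kato2004

end
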